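import Literature.AnabelianGeometry.SemiGraphs.BranchSubgroupLemmas
import Literature.AnabelianGeometry.SemiGraphs.FiniteEtaleCoveringGlobalDef
import Literature.AnabelianGeometry.SemiGraphs.CoveringBranchFrames
import HarnessLib

/-!
# Frames of branch subgroups; the aligned frame of a branch of a covering ([SemiAnbd] §2)

Mochizuki, *Semi-graphs of anabelioids*, Publ. RIMS **42** (2006) 221–322, §2: Definition 2.1
pp. 23–24 ("the image of `Π_b` in `Π_v`, which is well-defined up to conjugation"), Remark 2.2.1
p. 24, Remark 2.4.1 p. 26 [cite: MochizukiSemiAnbd2006, Def. 2.1 pp.23-24].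

PROOF-ONLY toolkit (abc-iut cell, L3 row G23 (d) step 2, abc-iut-L6-t17), the frame bookkeeping
behind the discharge of `covering_branchFibre_doubleCosets` (abc-iut-L3-t1) under
`Hom.IsBranchAligned` (ruling μ2, abc-iut-L4-t17, `FiniteEtaleCoveringGlobalDef.lean`):

* `branchSubgroup_map_autMulEquivOfIso` (change of VERTEX basepoint `β : G ≅ F`),
  `branchSubgroup_eq_of_edgeIso` (change of EDGE basepoint `δ : Φ ≅ F_e`), hence
  `branchSubgroup_eq_conjAct_smul_of_edgeIso`: every branch subgroup of `𝒢` at `b` in the frame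
  `F` is `x • Π_b` for the EXPLICIT transport element `x = α⁻¹ ≫ (b^*δ)⁻¹ ≫ T`;
* `transportAut_mul_inv_eq` — the quotient `x₁ x₂⁻¹` of two such elements is `Aut(β)` of the
  transition element `T₂⁻¹ ≫ b^*(δ₂ ≫ δ₁⁻¹) ≫ T₁` (the element of alignment clause (ii));
* `map_branchSubgroup_eq_inf_of_aligned` — abc-iut-L4-t17's `ι_Q(Π_{b'}) = ι_Q(Π_{v'}) ⊓ Π_b^{al}`
  (`CoveringBranchFrames.map_branchSubgroup_eq_range_inf_aligned`, alignment (i)) transported to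
  the frame `F` along `Aut(β)`;
* `alignIso_transition_eq` — for ONE branch and two basepoint data related by an isomorphism
  `θ''` of basepoints of `𝒢'_{e'}`, the transition element is `ι_Q` of an element of `Π_{v'}`.

All identities are proved at the level of `Aut` (transport along `≪≫` is functorial, `π₁(P)`
commutes with transport) — no choice of basepoint is privileged.
-/

namespace Literature.AnabelianGeometry.SemiGraphs

open CategoryTheory CategoryTheory.Limits CategoryTheory.Functor CategoryTheory.PreGaloisCategory
open Literature.AnabelianGeometry.Anabelioids
open scoped Pointwise

universe v₁ u₁ u

namespace SemiGraphOfAnabelioids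

variable {𝒢 𝒢' : SemiGraphOfAnabelioids.{v₁, u₁, u}}

/-! ### Frames of branch subgroups -/

section Frames

variable (𝒢) {v : 𝒢.graph.Vertex} (b : 𝒢.graph.Branch) (h : 𝒢.graph.abuts b = some v)

/-- Transport along `Aut(T)` then `Aut(β)` is transport along `Aut(T ≪≫ β)`. [folklore] -/
private theorem autMulEquivOfIso_trans_apply {C : Type*} [Category C] {X Y Z : C} (T : X ≅ Y)
    (β : Y ≅ Z) (σ : Aut X) :
    Aut.autMulEquivOfIso β (Aut.autMulEquivOfIso T σ) = Aut.autMulEquivOfIso (T ≪≫ β) σ := by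
  apply Aut.ext
  simp [Aut.autMulEquivOfIso]

/-- **Change of vertex basepoint.** Transporting a branch subgroup `Π_b ⊆ Aut G` along an
isomorphism of basepoints `β : G ≅ F` of `𝒢_v` gives the branch subgroup in the frame `F` for the
composite transport `T ≪≫ β`. [cite: MochizukiSemiAnbd2006, Def. 2.1 pp.23-24] -/
theorem branchSubgroup_map_autMulEquivOfIso {G F : 𝒢.V v ⥤ FintypeCat.{v₁}} (β : G ≅ F)
    (Φ : 𝒢.E (𝒢.graph.edgeOf b) ⥤ FintypeCat.{v₁}) (T : (𝒢.pull b v h).pullback ⋙ Φ ≅ G) :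
    (𝒢.branchSubgroup G b h Φ T).map (Aut.autMulEquivOfIso β).toMonoidHom =
      𝒢.branchSubgroup F b h Φ (T ≪≫ β) := by
  ext x
  simp only [Subgroup.mem_map, mem_branchSubgroup_iff, MulEquiv.coe_toMonoidHom]
  constructor
  · rintro ⟨_, ⟨σ, rfl⟩, rfl⟩
    exact ⟨σ, (autMulEquivOfIso_trans_apply T β _).symm⟩
  · rintro ⟨σ, rfl⟩
    exact ⟨_, ⟨σ, rfl⟩, autMulEquivOfIso_trans_apply T β _⟩

/-- `π₁(P)` commutes with transport of basepoints: `π₁(P)(Aut(δ) σ) = Aut(P ◁ δ)(π₁(P) σ)`.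
[cite: MochizukiGeoAn2004, Def. 1.1.2(ii) p.10] -/
theorem pi1Map_autMulEquivOfIso {C : Type*} [Category C] {D : Type*} [Category D] (P : C ⥤ D)
    {Φ Φ' : D ⥤ FintypeCat.{v₁}} (δ : Φ ≅ Φ') (σ : Aut Φ) :
    pi1Map P Φ' (Aut.autMulEquivOfIso δ σ) =
      Aut.autMulEquivOfIso (isoWhiskerLeft P δ) (pi1Map P Φ σ) := by
  apply Aut.ext
  rfl

/-- **Change of edge basepoint.** For an isomorphism `δ : Φ ≅ F_e` of basepoints of `𝒢_e`, the
branch subgroup for `(Φ, T)` is the branch subgroup for `(F_e, (b^* δ)⁻¹ ≫ T)`: `π₁(b^*)` commutes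
with the transports `Aut(δ)`, `Aut(b^* δ)`. [cite: MochizukiSemiAnbd2006, Def. 2.1 pp.23-24] -/
theorem branchSubgroup_eq_of_edgeIso {F : 𝒢.V v ⥤ FintypeCat.{v₁}}
    {Φ Fe : 𝒢.E (𝒢.graph.edgeOf b) ⥤ FintypeCat.{v₁}} (δ : Φ ≅ Fe)
    (T : (𝒢.pull b v h).pullback ⋙ Φ ≅ F) :
    𝒢.branchSubgroup F b h Φ T =
      𝒢.branchSubgroup F b h Fe ((isoWhiskerLeft (𝒢.pull b v h).pullback δ).symm ≪≫ T) := by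
  have key : ∀ σ : Aut Φ, Aut.autMulEquivOfIso T (𝒢.piBToPiV b v h Φ σ) =
      Aut.autMulEquivOfIso ((isoWhiskerLeft (𝒢.pull b v h).pullback δ).symm ≪≫ T)
        (𝒢.piBToPiV b v h Fe (Aut.autMulEquivOfIso δ σ)) := fun σ => by
    rw [piBToPiV, piBToPiV, pi1Map_autMulEquivOfIso, autMulEquivOfIso_trans_apply,
      ← Iso.trans_assoc, Iso.self_symm_id, Iso.refl_trans]
  ext x
  simp only [mem_branchSubgroup_iff]
  constructor
  · rintro ⟨σ, rfl⟩
    exact ⟨Aut.autMulEquivOfIso δ σ, (key σ).symm⟩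
  · rintro ⟨τ, rfl⟩
    refine ⟨(Aut.autMulEquivOfIso δ).symm τ, ?_⟩
    rw [key, MulEquiv.apply_symm_apply]

/-- Hence every branch subgroup of `𝒢` at `b` in the frame `F` is a conjugate `x • Π_b` of the
reference one `Π_b = branchSubgroup F b h F_e α`, by the EXPLICIT transport element
`x = α⁻¹ ≫ (b^*δ)⁻¹ ≫ T`. [cite: MochizukiSemiAnbd2006, Def. 2.1 pp.23-24] -/
theorem branchSubgroup_eq_conjAct_smul_of_edgeIso {F : 𝒢.V v ⥤ FintypeCat.{v₁}}
    {Φ Fe : 𝒢.E (𝒢.graph.edgeOf b) ⥤ FintypeCat.{v₁}} (δ : Φ ≅ Fe)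
    (T : (𝒢.pull b v h).pullback ⋙ Φ ≅ F) (α : (𝒢.pull b v h).pullback ⋙ Fe ≅ F) :
    𝒢.branchSubgroup F b h Φ T =
      ConjAct.toConjAct (transportAut α ((isoWhiskerLeft (𝒢.pull b v h).pullback δ).symm ≪≫ T)) •
        𝒢.branchSubgroup F b h Fe α := by
  rw [branchSubgroup_eq_of_edgeIso 𝒢 b h δ T]
  exact branchSubgroup_eq_conjAct_smul 𝒢 F b h Fe α _

/-- **The transition element between two frames.** For two edge basepoints `Φ₁, Φ₂` with transports
`Tᵢ : b^* ⋙ Φᵢ ≅ G`, `β : G ≅ F`, `δᵢ : Φᵢ ≅ F_e`, the transport elements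
`xᵢ = α⁻¹ ≫ (b^*δᵢ)⁻¹ ≫ Tᵢ ≫ β ∈ Aut F` satisfy `x₁ · x₂⁻¹ = Aut(β)(T₂⁻¹ ≫ b^*(δ₂ ≫ δ₁⁻¹) ≫ T₁)`.
[cite: MochizukiSemiAnbd2006, Rem. 2.2.1 p.24] -/
theorem transportAut_mul_inv_eq {G F : 𝒢.V v ⥤ FintypeCat.{v₁}} (β : G ≅ F)
    {Φ₁ Φ₂ Fe : 𝒢.E (𝒢.graph.edgeOf b) ⥤ FintypeCat.{v₁}} (δ₁ : Φ₁ ≅ Fe) (δ₂ : Φ₂ ≅ Fe)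
    (T₁ : (𝒢.pull b v h).pullback ⋙ Φ₁ ≅ G) (T₂ : (𝒢.pull b v h).pullback ⋙ Φ₂ ≅ G)
    (α : (𝒢.pull b v h).pullback ⋙ Fe ≅ F) :
    transportAut α ((isoWhiskerLeft (𝒢.pull b v h).pullback δ₁).symm ≪≫ T₁ ≪≫ β) *
        (transportAut α ((isoWhiskerLeft (𝒢.pull b v h).pullback δ₂).symm ≪≫ T₂ ≪≫ β))⁻¹ =
      Aut.autMulEquivOfIso β
        (T₂.symm ≪≫ isoWhiskerLeft (𝒢.pull b v h).pullback (δ₂ ≪≫ δ₁.symm) ≪≫ T₁ :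
          Aut G) := by
  apply Aut.ext
  refine NatTrans.ext (funext fun X => ?_)
  dsimp [transportAut, Aut.Aut_mul_def, Aut.Aut_inv_def, Aut.autMulEquivOfIso]
  simp

end Frames

/-! ### The aligned frame of a branch of the covering -/

section Aligned
variable (φ : Hom 𝒢' 𝒢) (v' : 𝒢'.graph.Vertex) (F' : 𝒢'.V v' ⥤ FintypeCat.{v₁})
  (b : 𝒢.graph.Branch) (b' : 𝒢'.graph.Branch) (h' : 𝒢'.graph.abuts b' = some v')
  (p : φ.base.branchMap b' = b)
  (Fe' : 𝒢'.E (𝒢'.graph.edgeOf b') ⥤ FintypeCat.{v₁}) (α' : (𝒢'.pull b' v' h').pullback ⋙ Fe' ≅ F')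

/-- The edge of a branch over `b` lies over the edge of `b`. [cite: MochizukiSemiAnbd2006, §1 p.11] -/
theorem Hom.edgeMap_edgeOf_eq_of_branchMap_eq (p : φ.base.branchMap b' = b) :
    φ.base.edgeMap (𝒢'.graph.edgeOf b') = 𝒢.graph.edgeOf b := by
  rw [← p]; exact (φ.base.edgeOf_branchMap b').symm

/-- **Same branch, two frames.** For ONE branch `b'` and two basepoint data `(F_e'₂, α'₂)`,
`(F_e', α')` related by `θ'' : F_e'₂ ≅ F_e'` (an isomorphism of basepoints of `𝒢'_{e'}`, i.e. coming
from UPSTAIRS), the transition element `AI₂⁻¹ ≫ b^*(φ_{e'}^* θ'') ≫ AI₁ ∈ Π_v` between the aligned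
frames is `ι_Q` of the element `α'₂⁻¹ ≫ (b')^*θ'' ≫ α' ∈ Π_{v'}` (naturality of `θ''` along the
2-cell `φ_{b'}`). [cite: MochizukiSemiAnbd2006, Rem. 2.4.1 p.26] -/
theorem alignIso_transition_eq
    (Fe'₂ : 𝒢'.E (𝒢'.graph.edgeOf b') ⥤ FintypeCat.{v₁})
    (α'₂ : (𝒢'.pull b' v' h').pullback ⋙ Fe'₂ ≅ F') (θ'' : Fe'₂ ≅ Fe') :
    ((φ.alignIso b' v' h' b p F' Fe'₂ α'₂).symm ≪≫
        isoWhiskerLeft (𝒢.pull b (φ.base.vertexMap v') (p ▸ φ.base.abuts_branchMap b' v' h')).pullback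
          (isoWhiskerLeft (φ.φE (𝒢'.graph.edgeOf b') (𝒢.graph.edgeOf b)
            (φ.edgeMap_edgeOf_eq_of_branchMap_eq b b' p)).pullback θ'') ≪≫
        φ.alignIso b' v' h' b p F' Fe' α' : Aut ((φ.φV v').pullback ⋙ F')) =
      pi1Map (φ.φV v').pullback F' (α'₂.symm ≪≫ isoWhiskerLeft (𝒢'.pull b' v' h').pullback θ'' ≪≫ α') := by
  apply Aut.ext
  refine NatTrans.ext (funext fun X => ?_)
  have nat := θ''.hom.naturality ((φ.φBOver b' v' h' b p).hom.app X)
  have hmap : Fe'.map ((φ.φBOver b' v' h' b p).hom.app X) ≫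
      Fe'.map ((φ.φBOver b' v' h' b p).inv.app X) = 𝟙 _ := by
    rw [← Fe'.map_comp, Iso.hom_inv_id_app, Fe'.map_id]
  show (α'₂.inv.app _ ≫ Fe'₂.map ((φ.φBOver b' v' h' b p).hom.app X)) ≫
      θ''.hom.app _ ≫ Fe'.map ((φ.φBOver b' v' h' b p).inv.app X) ≫ α'.hom.app _ =
    α'₂.inv.app _ ≫ θ''.hom.app _ ≫ α'.hom.app _
  erw [Category.assoc, reassoc_of% nat, reassoc_of% hmap]
  rfl

end Aligned

/-- **t1's equality form in the frame `F` of `𝒢_v`** (`β : φ_{v'}^* ⋙ F' ≅ F`,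
`ι = Aut(β) ∘ ι_Q`): under branch alignment, `ι(Π_{b'})` is `ι(Π_{v'}) ⊓` the branch subgroup of
`𝒢` at `b` for the edge basepoint `φ_{e'}^* ⋙ F_e'` and the transport `alignIso ≫ β` (abc-iut-L4-t17's
`map_branchSubgroup_eq_range_inf_aligned`, transported along `Aut(β)`).
[cite: MochizukiSemiAnbd2006, Rem. 2.4.1 p.26] -/
theorem map_branchSubgroup_eq_inf_of_aligned (φ : Hom 𝒢' 𝒢) (hal : φ.IsBranchAligned)
    (v' : 𝒢'.graph.Vertex) (F' : 𝒢'.V v' ⥤ FintypeCat.{v₁}) [FiberFunctor F']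
    (b : 𝒢.graph.Branch) (b' : 𝒢'.graph.Branch) (h' : 𝒢'.graph.abuts b' = some v')
    (p : φ.base.branchMap b' = b) (Fe' : 𝒢'.E (𝒢'.graph.edgeOf b') ⥤ FintypeCat.{v₁})
    [FiberFunctor Fe'] (α' : (𝒢'.pull b' v' h').pullback ⋙ Fe' ≅ F')
    {F : 𝒢.V (φ.base.vertexMap v') ⥤ FintypeCat.{v₁}}
    (β : (φ.φV v').pullback ⋙ F' ≅ F) (h : 𝒢.graph.abuts b = some (φ.base.vertexMap v')) :
    (𝒢'.branchSubgroup F' b' h' Fe' α').map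
        ((Aut.autMulEquivOfIso β).toMonoidHom.comp (pi1Map (φ.φV v').pullback F')) =
      ((Aut.autMulEquivOfIso β).toMonoidHom.comp (pi1Map (φ.φV v').pullback F')).range ⊓
        𝒢.branchSubgroup F b h _ (φ.alignIso b' v' h' b p F' Fe' α' ≪≫ β) := by
  rw [← Subgroup.map_map, map_branchSubgroup_eq_range_inf_aligned φ hal b' v' h' b p F' Fe' α',
    Subgroup.map_inf _ _ _ (Aut.autMulEquivOfIso β).injective, MonoidHom.range_comp]
  congr 1
  exact branchSubgroup_map_autMulEquivOfIso 𝒢 b _ β _ _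

end SemiGraphOfAnabelioids

end Literature.AnabelianGeometry.SemiGraphs
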